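import Literature.MathematicalPhysics.QuantumFieldTheory.Volkov2017.SamplingDegree

/-!
# Volkov's sampling exponents are bounded below by construction: Deg_2017 ≥ min(C_big, C_add + C_sat), Deg_2018 ≥ min(C_bigZ, C_add) — the printed sentence "Deg(s) > 0 is defined for each set s" made a kernel fact, uniformly in the graph and the line set

independent recomputation; certified where stated, statistical where stated; no new-physics claim.

CITATION HEADER (venture `QEDPrecision`, cell `pub-qed`, track TROPICAL seat V3a = `pub-qed-trop-v3-lit-1` gen 7; VALUE-FREE: the printed
sampler constants and the SHAPE of the printed formulas only — no integral, no Monte-Carlo value, nothing per graph or per Set V family).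
Serves `tropical/view/V3-VOLKOV-DEGREES.md` §A A.0.2 / A.6 / REF-PROTOCOL F4 ("on which words does g₀ already have E-dens > 0 everywhere"):
the exponent Volkov's Hepp-sector density g₀ = Π_l (z_{j_l}/z_{j_{l−1}})^{Deg(s^{[l]})}/Πz attaches to a sector edge is Deg of the TAIL SET,
so a lower bound on Deg that holds for EVERY graph `G : Gr` and EVERY line set `s` is a lower bound on E-dens on every edge of every sector
of every vertex graph the model types (graphs without lepton loops — the Set V scope).
Sources (as in `SamplingDegree.lean`, whose computable `Gr.deg17` / `Gr.deg18` are the objects here). [Volkov2017] S. Volkov, Phys. Rev.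
D 96, 096018 (2017) = arXiv:1705.05800, §III.B: (eq_mc_g0) "where Deg(s) > 0 is defined for each set s of internal lines of G except
the empty set and the set of all internal lines of G" (tex l.587–595; arXiv PDF p.11); (eq_deg) "Let C_sat ≥ 0, C_big > 0,
C_add > −C_sat be constants. By definition, put Deg(s) = C_big, if s contain all electron lines of G; C_add + max[C_sat,
min_{F∈𝔉_max[G]} Σ_{G′∈F} max(0, −ω*_{G′/F}(s))] otherwise." (l.756–766; PDF p.13); (eq_mc_constants) "C_big = 0.475, C_sat = 0.3,
C_add = 0.615" (l.809–814; PDF p.14). [Volkov2018] S. Volkov, Phys. Rev. D 98, 076018 (2018) = arXiv:1807.05281v2 §III (tex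
l.619–647; PDF p.11): "Let C_bigF > 0, C_bigZ > 0, C_add, C_subI, C_subSE, C_subO be constants. By definition, put Deg(s) = C_bigZ +
(C_bigF − C_bigZ) N_L(s)/N_L(G), if s contain all electron lines of G; C_add + min_{F∈𝔉_max[G]} Σ_{G′∈F} max(0, −ω*_{G′/F}(s) − D_sub[G′])
otherwise" and (eq_mc_constants) "C_bigZ = 0.256, C_bigF = 0.839, C_add = 0.786, C_subI = 0.2, C_subSE = 0, C_subO = 0.2" (the same six
values are PRD 100, 096004 (2019) (15), used unchanged at five loops; typed verbatim as `Volkov2024.SamplingDensityParameters.K18`).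

What the kernel certifies (elementary order reasoning on the printed formulas; `decide` for the one counterexample):
* `forestSum_nonneg`, `degCore_nonneg`, `lmin_nonneg`: every forest sum Σ max(0, ·) is ≥ 0, hence so is the min over maximal forests
  (and the 2018 min with the D_sub shifts) — for every graph, every shift function, every line set.
* `deg17_ge_min`: Deg_2017(s) ≥ min(C_big, C_add + C_sat) with NO hypothesis on the constants; `deg17_pos`: the printed hypotheses of
  (eq_deg) — C_big > 0 and C_add > −C_sat (C_sat ≥ 0 is not needed for this) — give Deg_2017(s) > 0, i.e. exactly the "Deg(s) > 0" that
  (eq_mc_g0) requires; `deg17_printed_ge`: with the printed constants Deg_2017(s) ≥ 0.475 = C_big (C_add + C_sat = 0.915).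
* `deg18_ge_min`: Deg_2018(s) ≥ min(C_bigZ, C_add) whenever C_bigZ ≤ C_bigF (the all-electron-lines branch is C_bigZ plus a
  non-negative multiple of C_bigF − C_bigZ; N_L counts are naturals); `deg18_printed_ge` / `deg18_printed_pos`: with the printed 2018 = 2019
  constants Deg_2018(s) ≥ 0.256 = C_bigZ > 0 for every graph and set.
* `deg18_printedHypotheses_not_sufficient`: unlike PRD 96, the HYPOTHESES printed in PRD 98 §III (only C_bigF > 0, C_bigZ > 0; C_add
  arbitrary) do not by themselves make Deg positive — on PRD 96's FIG. 4 graph (`figCross`, no UV-divergent subgraph) with C_bigZ = C_bigF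
  = 1, C_add = −2 and all shifts 0 the formula gives Deg({7}) = −1; positivity in 2018/2019 rests on the printed VALUES (C_add = 0.786 > 0).
NOT claimed: any UPPER bound (Deg ≤ C_bigF on the all-electron branch would need N_L(s) ≤ N_L(G), true but not proved for the list model
here); anything about the 2024 Deg₀ of PRD 110 (there C_BigZ > C_BigF, `Volkov2024.SamplingDensityParameters.topcase_monotonicity_flipped`,
so the analogous bound reads min(C_BigF, …)); anything about integrals, weights, variance or any Set V word — a positive density exponent is
finiteness of NOTHING (PRD 96 fn. at (eq_mc_constants): "no mathematical proof that (eq_deg) does not lead to case 3").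
-/

namespace Literature.MathematicalPhysics.QuantumFieldTheory.Volkov2017

/-! ## Non-negativity of the forest sums and of their minimum -/

/-- A sum of terms of the form max(0, ·) over any list is non-negative. [folklore] -/
private theorem sum_map_max_zero_nonneg {α : Type} (f : α → ℚ) :
    ∀ l : List α, 0 ≤ (l.map fun a => max 0 (f a)).sum
  | [] => le_rfl
  | a :: l => by
    simp only [List.map_cons, List.sum_cons]
    exact add_nonneg (le_max_left _ _) (sum_map_max_zero_nonneg f l)

/-- `foldl min` over non-negative rationals started at a non-negative value stays non-negative. [folklore] -/
private theorem foldl_min_nonneg : ∀ (xs : List ℚ) (x : ℚ), 0 ≤ x → (∀ y ∈ xs, 0 ≤ y) → 0 ≤ xs.foldl min x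
  | [], _, hx, _ => hx
  | y :: ys, x, hx, h =>
    foldl_min_nonneg ys (min x y) (le_min hx (h y (by simp))) fun z hz => h z (by simp [hz])

/-- The list minimum `lmin` of (eq_deg) is non-negative on a list of non-negative rationals (and is 0 on the empty list, by its
definition in `SamplingDegree`). [cite: Volkov2017, §III.B (eq_deg, l.756–766)] -/
theorem lmin_nonneg : ∀ l : List ℚ, (∀ x ∈ l, 0 ≤ x) → 0 ≤ lmin l
  | [], _ => le_rfl
  | x :: xs, h => foldl_min_nonneg xs x (h x (by simp)) fun y hy => h y (by simp [hy])

/-- "Σ_{G′∈F} max(0, −ω*_{G′/F}(s) − D_sub[G′])" is ≥ 0 for every forest F, every shift D_sub and every line set s (each summand is a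
max with 0). [cite: Volkov2018, §III (l.619–637)] -/
theorem forestSum_nonneg (G : Gr) (d : ℕ × ℕ → ℚ) (F : List (ℕ × ℕ)) (s : List ℕ) : 0 ≤ G.forestSum d F s :=
  sum_map_max_zero_nonneg (fun I => -(G.omegaStar (G.der I F) s) - d I) F

/-- "min_{F∈𝔉_max[G]} Σ_{G′∈F} max(0, −ω*_{G′/F}(s))" ≥ 0 for every graph and every line set. [cite: Volkov2017, §III.B (eq_deg, l.756–766)] -/
theorem degCore_nonneg (G : Gr) (s : List ℕ) : 0 ≤ G.degCore s :=
  lmin_nonneg _ fun x hx => by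
    obtain ⟨F, _, rfl⟩ := List.mem_map.mp hx
    exact forestSum_nonneg G _ F s

/-! ## PRD 96 (2017): Deg ≥ min(C_big, C_add + C_sat); the printed hypotheses give Deg > 0 -/

/-- Deg_2017(s) ≥ min(C_big, C_add + C_sat) for EVERY graph without lepton loops and EVERY line set s, with no hypothesis on the three
constants: the all-electron-lines branch IS C_big, the other branch is C_add + max[C_sat, (a min of non-negative sums)] ≥ C_add + C_sat.
[cite: Volkov2017, §III.B (eq_deg, l.756–766)] -/
theorem deg17_ge_min (G : Gr) (Cbig Cadd Csat : ℚ) (s : List ℕ) :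
    min Cbig (Cadd + Csat) ≤ G.deg17 Cbig Cadd Csat s := by
  unfold Gr.deg17
  split
  · exact min_le_left _ _
  · exact (min_le_right _ _).trans (add_le_add le_rfl (le_max_left _ _))

/-- The printed hypotheses "C_big > 0, C_add > −C_sat" of (eq_deg) make Deg_2017(s) > 0 for every graph and every s — the positivity
"Deg(s) > 0" that the density (eq_mc_g0) requires of its exponents (the third printed hypothesis C_sat ≥ 0 is not used).
[cite: Volkov2017, §III.B (eq_mc_g0, l.587–595; eq_deg, l.756–758)] -/
theorem deg17_pos (G : Gr) {Cbig Cadd Csat : ℚ} (hbig : 0 < Cbig) (hadd : -Csat < Cadd) (s : List ℕ) :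
    0 < G.deg17 Cbig Cadd Csat s :=
  lt_of_lt_of_le (lt_min hbig (neg_lt_iff_pos_add.mp hadd)) (deg17_ge_min G Cbig Cadd Csat s)

/-- With the printed constants (eq_mc_constants) "C_big = 0.475, C_sat = 0.3, C_add = 0.615" (= `K17`, stored as (C_big, C_sat, C_add)):
Deg_2017(s) ≥ 0.475 for every graph and every line set (min(0.475, 0.615 + 0.3) = 0.475 = C_big).
[cite: Volkov2017, §III.B (eq_mc_constants, l.809–814)] -/
theorem deg17_printed_ge (G : Gr) (s : List ℕ) : (0.475 : ℚ) ≤ G.deg17 K17.1 K17.2.2 K17.2.1 s :=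
  le_trans (by norm_num [K17]) (deg17_ge_min G K17.1 K17.2.2 K17.2.1 s)

/-! ## PRD 98 (2018) = PRD 100 (2019): Deg ≥ min(C_bigZ, C_add) when C_bigZ ≤ C_bigF; the printed values give Deg ≥ 0.256 -/

/-- Deg_2018(s) ≥ min(C_bigZ, C_add) for EVERY graph and EVERY line set, provided C_bigZ ≤ C_bigF (as printed: 0.256 ≤ 0.839): on the
all-electron-lines branch C_bigZ + (C_bigF − C_bigZ)·N_L(s)/N_L(G) the added term is a non-negative rational (N_L are naturals); on the
other branch C_add + min_F Σ max(0, −ω* − D_sub) ≥ C_add. No hypothesis on C_add or on the three shifts. [cite: Volkov2018, §III (l.619–637)] -/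
theorem deg18_ge_min (G : Gr) (CbigZ CbigF Cadd CsubI CsubSE CsubO : ℚ) (hZF : CbigZ ≤ CbigF) (s : List ℕ) :
    min CbigZ Cadd ≤ G.deg18 CbigZ CbigF Cadd CsubI CsubSE CsubO s := by
  unfold Gr.deg18
  split
  · exact (min_le_left _ _).trans (le_add_of_nonneg_right
      (div_nonneg (mul_nonneg (sub_nonneg.mpr hZF) (Nat.cast_nonneg _)) (Nat.cast_nonneg _)))
  · exact (min_le_right _ _).trans (le_add_of_nonneg_right (lmin_nonneg _ fun x hx => by
      obtain ⟨F, _, rfl⟩ := List.mem_map.mp hx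
      exact forestSum_nonneg G _ F s))

/-- With the printed constants (eq_mc_constants) of PRD 98 §III — "C_bigZ = 0.256, C_bigF = 0.839, C_add = 0.786, C_subI = 0.2, C_subSE = 0,
C_subO = 0.2", re-used unchanged in PRD 100 (15) for the five-loop graphs — Deg_2018(s) ≥ 0.256 = C_bigZ for every graph without lepton
loops and every line set (min(0.256, 0.786) = 0.256). [cite: Volkov2018, §III (eq_mc_constants, l.636–647)] -/
theorem deg18_printed_ge (G : Gr) (s : List ℕ) :
    (0.256 : ℚ) ≤ G.deg18 0.256 0.839 0.786 0.2 0 0.2 s :=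
  le_trans (by norm_num) (deg18_ge_min G 0.256 0.839 0.786 0.2 0 0.2 (by norm_num) s)

/-- Hence the 2018/2019 production exponents are strictly positive on every tail set of every Hepp sector of every graph without lepton
loops ("Deg(s) are positive real numbers", PRD 100 §III.A after (14)). [cite: Volkov2018, §III (eq_mc_constants, l.636–647)] -/
theorem deg18_printed_pos (G : Gr) (s : List ℕ) : 0 < G.deg18 0.256 0.839 0.786 0.2 0 0.2 s :=
  lt_of_lt_of_le (by norm_num) (deg18_printed_ge G s)

/-- What the 2018 HYPOTHESES alone do not give: PRD 98 §III prints "Let C_bigF > 0, C_bigZ > 0, C_add, C_subI, C_subSE, C_subO be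
constants" (C_add unrestricted, unlike PRD 96's C_add > −C_sat), and under such hypotheses the formula can be ≤ 0 — on PRD 96's FIG. 4
graph (the 3-loop crossed ladder `figCross`, 𝔉_max = {{G}}) with C_bigZ = C_bigF = 1, C_add = −2, all shifts 0, and s = {7} (one photon):
−ω*_G({7}) = 1, so Deg({7}) = −2 + max(0, 1 − 0) = −1. Positivity in 2018/2019 is carried by the printed VALUE C_add = 0.786, not by the
printed hypotheses. [cite: Volkov2018, §III (l.619–622)] -/
theorem deg18_printedHypotheses_not_sufficient :
    (0 : ℚ) < 1 ∧ figCross.deg18 1 1 (-2) 0 0 0 [7] = -1 := by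
  refine ⟨by norm_num, ?_⟩
  decide +kernel

end Literature.MathematicalPhysics.QuantumFieldTheory.Volkov2017
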